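import Mathlib.MeasureTheory.Function.LpSeminorm.CompareExp
import Mathlib.MeasureTheory.Function.LpSeminorm.Indicator
import Literature.Analysis.FluidPDE.NewtonLocalPotential
import HarnessLib

/-!
# Green's representation and the `L^p` estimate behind the decay of the pressure

Analysis/FluidPDE support file on the decomposition path of the named fact
`Literature.Analysis.FluidPDE.SereginSverak2009.PressureDecay` (G. Seregin, V. Šverák, Comm. PDE
34 (2009) = arXiv:0804.1803, proof of Lemma 3.5, (as13):
`D(z_b, ϱ; q) ≤ c[(ϱ/r) D(z_b, r; q) + (r/ϱ)² C(z_b, r; v)]`, `0 < ϱ ≤ r`). The printed sources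
prove such decay estimates by splitting the pressure on a ball into `q = q₁ + q₂`, `q₁` solving
`Δq₁ = -∂ᵢ∂ⱼ(vᵢvⱼ 1_B)` on `ℝ³` — bounded in `L^{3/2}` by `‖v‖²_{L³(B)}` through "the coercive
estimates for Laplace's operator" (Seregin, *Lecture notes on regularity theory for the
Navier–Stokes equations* (2014), (6.1.23)–(6.1.25) p. 92) — and a harmonic remainder `q₂`,
estimated in the interior by the mean value property (ibid. proof of Lemma 6.4, (6.1.43),
pp. 97–98). This file proves the one-slice core of that argument in the following **smooth,
fixed-scale** form, which avoids harmonic functions altogether: the truncated Newtonian kernel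
`Γ₀ = θΓ` of the tree at radii `(s/2, s)` (`FluidPDE/NewtonKernel`, `NewtonLocalPotential`) gives
Green's representation `g = N[Δg] + Λ[g]` for every `g ∈ C²(ℝ³)` (`N[h] = Γ₀ * h`, `Λ[g] = λ * g`,
`λ = Δ((1-θ)Γ)` smooth, supported in `|z| ≤ s`), so that

* (`eq_newtonFarSmoothing_sub_of_laplacian_eq`) if `ΔP = -Σᵢⱼ ∂ⱼ∂ᵢ Tᵢⱼ` holds pointwise on the
  `s`-neighbourhood of a set `S`, then on `S`
  `P = Λ[P] - Σᵢⱼ ∂ⱼ∂ᵢ N[Tᵢⱼ]`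
  (the smoothing `Λ[P]` plays the part of the harmonic remainder, the potentials that of `q₁`);
* (`eLpNorm_indicator_le_of_laplacian_eq`) consequently, for `P ∈ C²`, `Tᵢⱼ ∈ C²_c` and a
  measurable `S`,
  `‖1_S P‖_{3/2} ≤ |S|^{2/3} M |B_s|^{1/3} ‖P‖_{3/2} + C Σᵢⱼ ‖Tᵢⱼ‖_{3/2}`,
  where `M = sup|λ|` (`|Λ[P](x)| ≤ M ∫_{B(x,s)}|P| ≤ M |B_s|^{1/3} ‖P‖_{3/2}`, Hölder) and `C` is
  any constant for which the Calderón–Zygmund bound `‖∂ₐ∂_c N[g]‖_{3/2} ≤ C‖g‖_{3/2}`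
  (`g ∈ C²_c`, `|a|, |c| ≤ 1`) holds at this scale — the conclusion of
  `stein1970_hessian_Lp_bound.hessian_newtonNearPotential_half` (`FluidPDE/HessianLaplacianLp`,
  from Stein 1970, III §1.3, Prop. 3), taken here as a HYPOTHESIS so that this file asserts
  nothing.

With `S = 𝒞(x₀, ϱ)`, `s = r/2`, `M = (2/r)³ sup|λ_{1/2,1}|` (scaling of `λ`) the first constant is
`c (ϱ/r)²`, which after integration in time is the factor `(ϱ/r)` of (as13) in front of `D`;
this is carried out, for the space–time mollifications of a distributional Navier–Stokes
solution (`FluidPDE/MollifiedPressurePoisson`), in the sequel files.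

## References

* G. Seregin, V. Šverák, Comm. PDE 34 (2009) 171–201 = arXiv:0804.1803, proof of Lemma 3.5,
  (as13). [`SereginSverak2009`]
* G. Seregin, *Lecture notes on regularity theory for the Navier–Stokes equations*, World
  Scientific (2014), (6.1.23)–(6.1.25) p. 92; Lemma 6.4 and (6.1.39)–(6.1.43), pp. 97–98.
  [`Seregin2014`]
* D. Gilbarg, N. S. Trudinger, *Elliptic partial differential equations of second order* (2001),
  (2.16)–(2.17) (Green's representation formula). [`GilbargTrudinger2001`]
* E. M. Stein, *Singular integrals and differentiability properties of functions* (1970), Ch. III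
  §1.3, Prop. 3. [`Stein1971`]
-/

noncomputable section

open MeasureTheory Set Filter Function Metric
open scoped ENNReal NNReal Laplacian Convolution

namespace Literature.Analysis.FluidPDE

/-- Local notation for physical space `ℝ³ = EuclideanSpace ℝ (Fin 3)`. -/
local notation "ℝ³" => EuclideanSpace ℝ (Fin 3)

variable {ι : Type*} [Fintype ι]

/-! ### Numerical facts about the exponent `3/2` in `ℝ≥0∞` -/

/-- `1 ≤ 3/2` in `ℝ≥0∞` (private copy of a one-liner also found in unrelated tree files). [folklore] -/
private theorem one_le_three_halves_ennreal : (1 : ℝ≥0∞) ≤ 3 / 2 := by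
  rw [ENNReal.le_div_iff_mul_le (Or.inl (by norm_num)) (Or.inl (by norm_num)), one_mul]
  exact_mod_cast (by norm_num : (2 : ℕ) ≤ 3)

/-- `(3/2).toReal = 3/2`. [folklore] -/
private theorem toReal_three_halves : (3 / 2 : ℝ≥0∞).toReal = 3 / 2 := by
  rw [ENNReal.toReal_div, ENNReal.toReal_ofNat, ENNReal.toReal_ofNat]

/-! ### Green's representation under the pressure equation -/

/-- Locality of the truncated Newtonian potential: `N[g₁](x) = N[g₂](x)` as soon as `g₁` and
`g₂` agree on `B̄(x, r₁)` (`Γ₀` vanishes off `B̄(0, r₁)`). [folklore] -/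
theorem newtonNearPotential_congr_of_forall {r₀ r₁ : ℝ} (h₀ : 0 ≤ r₀) (h₁ : r₀ < r₁)
    {g₁ g₂ : ℝ³ → ℝ} {x : ℝ³} (h : ∀ z : ℝ³, ‖z‖ ≤ r₁ → g₁ (x - z) = g₂ (x - z)) :
    newtonNearPotential r₀ r₁ g₁ x = newtonNearPotential r₀ r₁ g₂ x := by
  rw [newtonNearPotential_apply, newtonNearPotential_apply]
  refine integral_congr_ae (Eventually.of_forall fun z => ?_)
  by_cases hz : ‖z‖ ≤ r₁
  · simp only [h z hz]
  · simp only [newtonNear_eq_zero h₀ h₁ (not_le.1 hz).le, zero_mul]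

/-- Linearity of the truncated Newtonian potential over negated finite double sums of continuous
functions. [folklore] -/
theorem newtonNearPotential_neg_sum_sum {r₀ r₁ : ℝ} (h₀ : 0 ≤ r₀) (h₁ : r₀ < r₁)
    {G : ι → ι → ℝ³ → ℝ} (hG : ∀ i j, Continuous (G i j)) (x : ℝ³) :
    newtonNearPotential r₀ r₁ (fun y => -∑ i, ∑ j, G i j y) x =
      -∑ i, ∑ j, newtonNearPotential r₀ r₁ (G i j) x := by
  have hint : ∀ i j, Integrable fun z => newtonNear r₀ r₁ z * G i j (x - z) := fun i j => by
    have := integrable_smul_comp_sub (integrable_newtonNear h₀ h₁) (newtonNear_eq_zero_of_lt h₀ h₁)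
      (hG i j) x
    simpa only [smul_eq_mul] using this
  simp only [newtonNearPotential_apply, mul_neg, Finset.mul_sum, integral_neg]
  rw [integral_finsetSum _ fun i _ => integrable_finsetSum _ fun j _ => hint i j]
  exact congrArg Neg.neg (Finset.sum_congr rfl fun i _ => integral_finsetSum _ fun j _ => hint i j)

/-- **Green's representation under the pressure equation.** Let `P ∈ C²(ℝ³)` and
`Tᵢⱼ ∈ C²(ℝ³)` satisfy `ΔP(y) = -Σᵢ Σⱼ ∂_{aⱼ}∂_{aᵢ} Tᵢⱼ(y)` at every point `y = x - z` with `x ∈ S`,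
`|z| ≤ s` (the pressure equation on the `s`-neighbourhood of `S`). Then for `x ∈ S`
`P(x) = Λ[P](x) - Σᵢ Σⱼ ∂_{aⱼ}∂_{aᵢ} N[Tᵢⱼ](x)`, with `N`, `Λ` the truncated Newtonian potential and
its smoothing remainder at radii `(s/2, s)` (Green's representation `P = N[ΔP] + Λ[P]`,
Gilbarg–Trudinger (2.16)–(2.17) localised, `eq_newtonNearPotential_laplacian_add`; locality of
`N`; and `N[∂∂T] = ∂∂N[T]`). This is the decomposition `q = q₁ + q₂` of the pressure of Seregin
2014, (6.1.23)/(6.1.39), at a fixed scale. [cite: Seregin2014, (6.1.39)–(6.1.41) p. 97] -/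
theorem eq_newtonFarSmoothing_sub_of_laplacian_eq {P : ℝ³ → ℝ} (hP : ContDiff ℝ 2 P)
    {T : ι → ι → ℝ³ → ℝ} (hT : ∀ i j, ContDiff ℝ 2 (T i j)) (a : ι → ℝ³) {S : Set ℝ³} {s : ℝ}
    (hs : 0 < s)
    (hEq : ∀ x ∈ S, ∀ z : ℝ³, ‖z‖ ≤ s → (Δ P) (x - z) =
      -∑ i, ∑ j, fderiv ℝ (fun w => fderiv ℝ (T i j) w (a i)) (x - z) (a j))
    {x : ℝ³} (hx : x ∈ S) :
    P x = newtonFarSmoothing (s / 2) s P x -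
      ∑ i, ∑ j, fderiv ℝ (fun w => fderiv ℝ (newtonNearPotential (s / 2) s (T i j)) w (a i)) x
        (a j) := by
  have h₀ : 0 < s / 2 := by positivity
  have h₁ : s / 2 < s := by linarith
  have hG : ∀ i j, Continuous fun y => fderiv ℝ (fun w => fderiv ℝ (T i j) w (a i)) y (a j) :=
    fun i j => continuous_fderiv_fderiv_apply (hT i j) (a i) (a j)
  rw [eq_newtonNearPotential_laplacian_add h₀ h₁ hP x,
    newtonNearPotential_congr_of_forall h₀.le h₁
      (g₂ := fun y => -∑ i, ∑ j, fderiv ℝ (fun w => fderiv ℝ (T i j) w (a i)) y (a j)) (hEq x hx),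
    newtonNearPotential_neg_sum_sum h₀.le h₁ hG]
  rw [add_comm, ← sub_eq_add_neg]
  congr 1
  refine Finset.sum_congr rfl fun i _ => Finset.sum_congr rfl fun j _ => ?_
  exact (fderiv_fderiv_newtonNearPotential_apply h₀.le h₁ (hT i j) x (a i) (a j)).symm

/-! ### The smoothing remainder: a pointwise bound by Hölder's inequality -/

/-- **Pointwise bound for the smoothing remainder.** If `|λ_{s/2,s}| ≤ M` then for every
`P ∈ C(ℝ³)` and every `x`,
`‖Λ[P](x)‖ ≤ M |B̄(0, s)|^{1/3} ‖P‖_{L^{3/2}(ℝ³)}`: `|Λ[P](x)| ≤ ∫_{|z| ≤ s} |λ(z)| |P(x - z)| dz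
≤ M ∫_{B̄(x,s)} |P| ≤ M |B̄_s|^{1/3} ‖P‖_{3/2}` (Hölder on the ball). This is the interior
estimate of the harmonic part of the pressure (Seregin 2014, (6.1.43)) in smoothed form.
[folklore] -/
theorem enorm_newtonFarSmoothing_le {s : ℝ} (hs : 0 < s) {M : ℝ≥0}
    (hM : ∀ z, ‖newtonFarLaplacian (s / 2) s z‖₊ ≤ M) {P : ℝ³ → ℝ} (hP : Continuous P) (x : ℝ³) :
    ‖newtonFarSmoothing (s / 2) s P x‖ₑ ≤
      M * volume (closedBall (0 : ℝ³) s) ^ (1 / 3 : ℝ) * eLpNorm P (3 / 2) volume := by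
  have h₀ : 0 < s / 2 := by positivity
  have h₁ : s / 2 < s := by linarith
  have hPm : AEStronglyMeasurable P volume := hP.aestronglyMeasurable
  -- `|Λ[P](x)| ≤ ∫ |λ| |P(x - ·)| = ∫_{B̄(0,s)} |λ| |P(x - ·)| ≤ M ∫_{B̄(0,s)} |P(x - ·)|`
  have hvan : ∀ z, z ∉ closedBall (0 : ℝ³) s →
      ‖newtonFarLaplacian (s / 2) s z‖ₑ * ‖P (x - z)‖ₑ = 0 := fun z hz => by
    rw [mem_closedBall_zero_iff, not_le] at hz
    rw [newtonFarLaplacian_eq_zero_of_gt h₀.le h₁ hz, enorm_zero, zero_mul]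
  have step1 : ‖newtonFarSmoothing (s / 2) s P x‖ₑ ≤
      M * ∫⁻ z in closedBall (0 : ℝ³) s, ‖P (x - z)‖ₑ := by
    rw [newtonFarSmoothing_eq_convolution]
    refine (UnboundedOperators.enorm_convolution_lsmul_le _ _ x).trans ?_
    have hind : (fun z => ‖newtonFarLaplacian (s / 2) s z‖ₑ * ‖P (x - z)‖ₑ) =
        (closedBall (0 : ℝ³) s).indicator
          fun z => ‖newtonFarLaplacian (s / 2) s z‖ₑ * ‖P (x - z)‖ₑ := by
      funext z
      by_cases hz : z ∈ closedBall (0 : ℝ³) s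
      · rw [indicator_of_mem hz]
      · rw [indicator_of_notMem hz, hvan z hz]
    rw [hind, lintegral_indicator measurableSet_closedBall,
      ← lintegral_const_mul' _ _ ENNReal.coe_ne_top]
    refine lintegral_mono fun z => ?_
    gcongr
    exact enorm_le_coe.2 (hM z)
  -- Hölder on the ball: `∫_{B̄} |P(x - ·)| ≤ |B̄|^{1/3} ‖P(x - ·)‖_{3/2} = |B̄|^{1/3} ‖P‖_{3/2}`
  have step2 : ∫⁻ z in closedBall (0 : ℝ³) s, ‖P (x - z)‖ₑ ≤
      volume (closedBall (0 : ℝ³) s) ^ (1 / 3 : ℝ) * eLpNorm P (3 / 2) volume := by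
    have hmp : MeasurePreserving (fun z : ℝ³ => x - z) volume volume :=
      Measure.measurePreserving_sub_left volume x
    have hPx : AEStronglyMeasurable (fun z => P (x - z)) (volume.restrict (closedBall (0 : ℝ³) s)) :=
      (hP.comp (continuous_const.sub continuous_id)).aestronglyMeasurable
    have h1 : ∫⁻ z in closedBall (0 : ℝ³) s, ‖P (x - z)‖ₑ =
        eLpNorm (fun z => P (x - z)) 1 (volume.restrict (closedBall (0 : ℝ³) s)) := by
      rw [eLpNorm_one_eq_lintegral_enorm]
    have h2 := eLpNorm_le_eLpNorm_mul_rpow_measure_univ (p := 1) (q := (3 / 2 : ℝ≥0∞))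
      one_le_three_halves_ennreal hPx
    rw [Measure.restrict_apply_univ, ENNReal.toReal_one, toReal_three_halves] at h2
    have h3 : eLpNorm (fun z => P (x - z)) (3 / 2) (volume.restrict (closedBall (0 : ℝ³) s)) ≤
        eLpNorm P (3 / 2) volume := by
      refine (eLpNorm_restrict_le _ _ _ _).trans_eq ?_
      exact eLpNorm_comp_measurePreserving (p := (3 / 2 : ℝ≥0∞)) hPm hmp
    rw [h1]
    calc eLpNorm (fun z => P (x - z)) 1 (volume.restrict (closedBall (0 : ℝ³) s))
        ≤ eLpNorm (fun z => P (x - z)) (3 / 2) (volume.restrict (closedBall (0 : ℝ³) s)) *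
            volume (closedBall (0 : ℝ³) s) ^ (1 / (1 : ℝ) - 1 / (3 / 2 : ℝ)) := h2
      _ ≤ eLpNorm P (3 / 2) volume * volume (closedBall (0 : ℝ³) s) ^ (1 / 3 : ℝ) := by
          rw [show (1 / (1 : ℝ) - 1 / (3 / 2 : ℝ)) = 1 / 3 by norm_num]
          gcongr
      _ = volume (closedBall (0 : ℝ³) s) ^ (1 / 3 : ℝ) * eLpNorm P (3 / 2) volume := mul_comm _ _
  calc ‖newtonFarSmoothing (s / 2) s P x‖ₑ
      ≤ M * ∫⁻ z in closedBall (0 : ℝ³) s, ‖P (x - z)‖ₑ := step1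
    _ ≤ M * (volume (closedBall (0 : ℝ³) s) ^ (1 / 3 : ℝ) * eLpNorm P (3 / 2) volume) := by
        gcongr
    _ = M * volume (closedBall (0 : ℝ³) s) ^ (1 / 3 : ℝ) * eLpNorm P (3 / 2) volume := by
        rw [mul_assoc]

/-! ### The `L^{3/2}` estimate on a measurable set -/

/-- **The `L^{3/2}` estimate behind the decay of the pressure.** Let `P ∈ C²(ℝ³)` and
`Tᵢⱼ ∈ C²_c(ℝ³)` satisfy the pressure equation `ΔP = -Σᵢⱼ ∂_{aⱼ}∂_{aᵢ}Tᵢⱼ` on the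
`s`-neighbourhood of a measurable set `S` (directions `|aᵢ| ≤ 1`), let `|λ_{s/2,s}| ≤ M`, and
suppose the Calderón–Zygmund bound `‖∂ₐ∂_cN[g]‖_{3/2} ≤ C‖g‖_{3/2}` holds at the radii `(s/2, s)`
for all `g ∈ C²_c`, `|a|, |c| ≤ 1` (Stein 1970, III §1.3 Prop. 3, in the form
`stein1970_hessian_Lp_bound.hessian_newtonNearPotential_half`). Then
`‖1_S P‖_{3/2} ≤ |S|^{2/3} M |B̄_s|^{1/3} ‖P‖_{3/2} + C Σᵢ Σⱼ ‖Tᵢⱼ‖_{3/2}` — on `S`,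
`P = Λ[P] - Σ ∂∂N[Tᵢⱼ]` (`eq_newtonFarSmoothing_sub_of_laplacian_eq`), the first term is bounded
pointwise (`enorm_newtonFarSmoothing_le`) and the others by the Calderón–Zygmund bound. The two
terms are the contributions of `p₂` (harmonic) and `p₁` (`|v|²`-controlled) in Seregin 2014,
proof of Lemma 6.4. [cite: Seregin2014, Lemma 6.4 (proof) pp. 97–98] -/
theorem eLpNorm_indicator_le_of_laplacian_eq {P : ℝ³ → ℝ} (hP : ContDiff ℝ 2 P)
    {T : ι → ι → ℝ³ → ℝ} (hT : ∀ i j, ContDiff ℝ 2 (T i j)) (hTc : ∀ i j, HasCompactSupport (T i j))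
    {a : ι → ℝ³} (ha : ∀ i, ‖a i‖ ≤ 1) {S : Set ℝ³} (hS : MeasurableSet S) {s : ℝ} (hs : 0 < s)
    (hEq : ∀ x ∈ S, ∀ z : ℝ³, ‖z‖ ≤ s → (Δ P) (x - z) =
      -∑ i, ∑ j, fderiv ℝ (fun w => fderiv ℝ (T i j) w (a i)) (x - z) (a j))
    {M : ℝ≥0} (hM : ∀ z, ‖newtonFarLaplacian (s / 2) s z‖₊ ≤ M) {C : ℝ≥0∞}
    (hCZ : ∀ g : ℝ³ → ℝ, ContDiff ℝ 2 g → HasCompactSupport g → ∀ a' c' : ℝ³, ‖a'‖ ≤ 1 →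
      ‖c'‖ ≤ 1 → eLpNorm (fun x => fderiv ℝ (fun y => fderiv ℝ
        (newtonNearPotential (s / 2) s g) y a') x c') (3 / 2) volume ≤ C * eLpNorm g (3 / 2) volume) :
    eLpNorm (S.indicator P) (3 / 2) volume ≤
      volume S ^ (2 / 3 : ℝ) * (M * volume (closedBall (0 : ℝ³) s) ^ (1 / 3 : ℝ) *
          eLpNorm P (3 / 2) volume) +
        C * ∑ i, ∑ j, eLpNorm (T i j) (3 / 2) volume := by
  have h₀ : 0 < s / 2 := by positivity
  have h₁ : s / 2 < s := by linarith
  have hp1 : (1 : ℝ≥0∞) ≤ 3 / 2 := one_le_three_halves_ennreal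
  -- the two pieces
  set L : ℝ³ → ℝ := newtonFarSmoothing (s / 2) s P with hL
  set D : ι → ι → ℝ³ → ℝ := fun i j x =>
    fderiv ℝ (fun w => fderiv ℝ (newtonNearPotential (s / 2) s (T i j)) w (a i)) x (a j) with hD
  have hLc : Continuous L := continuous_newtonFarSmoothing h₀ h₁ hP.continuous
  have hDc : ∀ i j, Continuous (D i j) := fun i j =>
    continuous_fderiv_fderiv_apply (contDiff_newtonNearPotential h₀.le h₁ 2
      (by exact_mod_cast hT i j)) (a i) (a j)
  have hLm : AEStronglyMeasurable (S.indicator L) volume :=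
    hLc.aestronglyMeasurable.indicator hS
  have hDm : ∀ i j, AEStronglyMeasurable (D i j) volume := fun i j => (hDc i j).aestronglyMeasurable
  have hsumm : AEStronglyMeasurable (S.indicator fun x => ∑ i, ∑ j, D i j x) volume :=
    (continuous_finsetSum _ fun i _ => continuous_finsetSum _ fun j _ => hDc i j)
      |>.aestronglyMeasurable.indicator hS
  -- the representation on `S`, as an identity of indicators
  have hrep : S.indicator P = S.indicator L - S.indicator fun x => ∑ i, ∑ j, D i j x := by
    funext x
    simp only [Pi.sub_apply]
    by_cases hx : x ∈ S
    · rw [indicator_of_mem hx, indicator_of_mem hx, indicator_of_mem hx]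
      exact eq_newtonFarSmoothing_sub_of_laplacian_eq hP hT a hs hEq hx
    · simp only [indicator_of_notMem hx, sub_zero]
  -- first piece: pointwise bound on `S`
  have hLb : eLpNorm (S.indicator L) (3 / 2) volume ≤
      volume S ^ (2 / 3 : ℝ) *
        (M * volume (closedBall (0 : ℝ³) s) ^ (1 / 3 : ℝ) * eLpNorm P (3 / 2) volume) := by
    rw [eLpNorm_indicator_eq_eLpNorm_restrict hS]
    have hb : ∀ᵐ x ∂(volume.restrict S), ‖L x‖ₑ ≤
        M * volume (closedBall (0 : ℝ³) s) ^ (1 / 3 : ℝ) * eLpNorm P (3 / 2) volume :=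
      Eventually.of_forall fun x => enorm_newtonFarSmoothing_le hs hM hP.continuous x
    refine (eLpNorm_le_of_ae_enorm_bound hb).trans_eq ?_
    rw [Measure.restrict_apply_univ, smul_eq_mul, mul_comm, toReal_three_halves,
      show (3 / 2 : ℝ)⁻¹ = 2 / 3 by norm_num]
  -- second piece: Minkowski and the Calderón–Zygmund bound
  have hDb : eLpNorm (S.indicator fun x => ∑ i, ∑ j, D i j x) (3 / 2) volume ≤
      C * ∑ i, ∑ j, eLpNorm (T i j) (3 / 2) volume := by
    refine (eLpNorm_indicator_le _).trans ?_
    have hfun : (fun x => ∑ i, ∑ j, D i j x) = ∑ i, ∑ j, D i j := by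
      funext x; simp only [Finset.sum_apply]
    rw [hfun, Finset.mul_sum]
    refine (eLpNorm_sum_le (fun i _ => Finset.aestronglyMeasurable_sum _ fun j _ => hDm i j)
      hp1).trans (Finset.sum_le_sum fun i _ => ?_)
    rw [Finset.mul_sum]
    refine (eLpNorm_sum_le (fun j _ => hDm i j) hp1).trans (Finset.sum_le_sum fun j _ => ?_)
    exact hCZ (T i j) (hT i j) (hTc i j) (a i) (a j) (ha i) (ha j)
  -- conclude
  rw [hrep]
  exact (eLpNorm_sub_le hLm hsumm hp1).trans (add_le_add hLb hDb)

end Literature.Analysis.FluidPDE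

end
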